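import Literature.Probability.RandomPlanarGeometry.HexSAWSurfaceDensity
import Literature.Probability.RandomPlanarGeometry.HexSAWSurfaceYcLimitAllY
import Literature.Probability.RandomPlanarGeometry.HexSAWSurfaceOrderParameter
import Mathlib.Analysis.SpecialFunctions.Log.Basic
import Mathlib.Analysis.SpecialFunctions.Pow.Real
import HarnessLib

/-!
# «EXPLICIT-DENSITY» An explicit eventual lower bound on the mean density of surface vertices of honeycomb half-plane
# walks in the adsorbed phase, from any certified free-energy excess: for `y > y_c = 1 + √2` and `L ≤ μ(y)²`,
# every `δ < log (L/μ²) / (2 log (y/y_c))` has `δ ≤ density_n(y)` for all large `n`; data-free,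
# every `δ < 1/2 − log 2 / (4 log (y/y_c))`; with the length-12 bridge certificate `400/117 ≤ μ(3)²`, `1/400 ≤ density_n(3)`;
# the same floors bound the limiting order parameter: `ρ⁻(log y) ≥ log (L/μ²) / (2 log (y/y_c))`, `ρ⁻(log 3) > 1/400`

Topic `Literature/Probability/RandomPlanarGeometry` (lane «pcv-sawmu», a-idea-1 g28, door «EXPLICIT-DENSITY»; parents, all in the
tree: `HexSAWSurfaceDensity.lean` — the finite-`n` mean density `surfDensity n y = surfMoment n y / (n · C_n(y))` of surface
vertices of `n`-vertex half-plane walks, the chord inequality `le_surfDensity_of_ratio_le`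
(`C_n(y₀)/C_n(y) ≤ θⁿ → log θ / log (y₀/y) ≤ surfDensity n y`), `frequently_le_surfDensity_of_gt` (SOME `δ > 0` infinitely often,
`y > y_c`) and `eventually_le_surfDensity_of_gt_sq` (SOME `δ > 0` eventually, `y > μ²`); `HexSAWSurfaceYcGrowth.lean`
(`growthLe_criticalPoint : C_n(y_c) ≤ sⁿ` eventually for every `s > μ`); `HexSAWSurfaceYcLimitAllY.lean` (`surfaceMu y = μ(y)`,
`growthGeRate_surfaceMu : rⁿ ≤ C_n(y)` eventually for every `r < μ(y)`, `hexConnectiveConstant_lt_surfaceMu_iff : μ < μ(y) ↔ y > 1 + √2`,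
`sqrt_le_surfaceMu : √y ≤ μ(y)`); `HexSAWSurfaceOrderParameter.lean` (`surfFreeEnergy t = log μ(eᵗ)`, its one-sided derivatives
`surfLeftDensity t ≤ surfRightDensity t` — the limiting densities — and the chord bound `div_le_surfLeftDensity`)).

THE SOURCE, AS PRINTED.  Beaton, Bousquet-Mélou, de Gier, Duminil-Copin and Guttmann [BeatonBousquetMelouDeGierDuminilCopinGuttmann2014,
§3.1], after Proposition 5 (arXiv v5 p. 9: `μ(y)` "is a … non-decreasing function of `y`", `μ(y) = μ` for `y ≤ y_c`, `μ(y) > μ`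
for `y > y_c`, `μ(y) ≥ max(μ, √y)`), write in the last paragraph of §3.1 (p. 10): "… we see that the density of vertices on the
surface is 0 for y < y_c and is positive for y > y_c: in other words, the critical value y_c distinguishes between the desorbed
and adsorbed phases", the density being the mean fraction `(1/n) Σ_i i c_n^+(i) yⁱ / Σ_i c_n^+(i) yⁱ` of vertices in the surface;
and "Theorem 2. The critical surface fugacity for self-avoiding walks on the honeycomb lattice is y_c = 1 + √2." (p. 3).  The
surface free energy `log μ(y)` and its `log y`-derivative as the limiting density of visits go back to Hammersley, Torrie and
Whittington [HammersleyTorrieWhittington1982, §3]; `μ = √(2+√2)` is [DuminilCopinSmirnov2012, Theorem 1].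

WHAT THIS FILE PROVES (new: the EXPLICIT, CERTIFICATE-DRIVEN form of "positive for y > y_c").  The tree's positivity results (and the
lane's DENSITY-LIMIT car, `eventually_le_surfDensity_of_gt`: SOME `δ > 0` eventually, for every `y > y_c`, by the same chord) give an
unspecified `δ`; here `δ` is a closed-form function of any certified lower bound `L ≤ μ(y)²`:
* §1 `eventually_le_surfDensity_of_rates` — for `y > 1 + √2` and rates `μ < s < r < μ(y)`: eventually
  `log (r/s) / log (y/(1+√2)) ≤ surfDensity n y` (the chord from `y_c` to `y`: `C_n(y_c) ≤ sⁿ`, `rⁿ ≤ C_n(y)`).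
* §2 the floor `surfDensityFloor L y := log (L/μ²) / (2 · log (y/(1+√2)))`, monotone in `L` and positive iff `L > μ²`, and
  ★ `eventually_le_surfDensity_of_lt_floor` — for `y > 1 + √2`, `0 < L ≤ μ(y)²` and EVERY `δ < surfDensityFloor L y`: eventually
  `δ ≤ surfDensity n y`; packaged as `eventually_half_floor_le_surfDensity` (`δ = ½ · floor`, positive when `μ² < L`).
* §3 DATA-FREE (`L = y ≤ μ(y)²`, `μ²/(1+√2) = √2`): `surfDensityFloor y y = 1/2 − log 2 / (4 log (y/(1+√2)))` and
  ★ `eventually_le_surfDensity_explicit` — for `y > 1 + √2` and every `δ < 1/2 − log 2 / (4 log (y/(1+√2)))`, eventually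
  `δ ≤ surfDensity n y`: the mean surface density approaches its maximal value `1/2` as `y → ∞` at least at this explicit
  logarithmic rate (positive content for `y > μ² = 2 + √2`; the tree's `eventually_le_surfDensity_of_gt_sq` made explicit).
* §4 WITH DATA: given the certificate `400/117 ≤ μ(3)²` (hypothesis `hβ`; kernel-certified in the lane from the census of
  irreducible positive wall bridges of length `≤ 12` via the strip renewal inequality [MadrasSlade1993, §4.2] — HOME car
  «STRIP-ADSORPTION-WITNESS», `le_sq_surfaceMu_of_three_le`), ★ `eventually_inv_four_hundred_le_surfDensity_three`: eventually
  **`1/400 ≤ surfDensity n 3`** — at `y = 3`, inside the window `(y_c, μ²]` where the tree had positivity only "infinitely often",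
  on average at least one vertex in `400` of a long walk lies on the surface.  The number is small because the certified excess
  `400/117 − (2+√2) ≈ 0.0046` is; the floor is `log (L/μ²)/(2 log (y/y_c))`, so the deeper census value `μ(3)² ≥ 3.597`
  (length `≤ 44`, lane numerics, NOT a kernel fact) would give `δ` up to `0.12`.
* §5 ORDER PARAMETER (no `∀ᶠ`): the chord value of the tree's `div_le_surfLeftDensity` IS `surfDensityFloor (μ(y)²) y`, hence
  ★ `surfDensityFloor_le_surfLeftDensity` — `0 < L ≤ μ(eᵗ)²`, `eᵗ > y_c` ⇒ `surfDensityFloor L (eᵗ) ≤ ρ⁻(t) ≤ ρ⁺(t)`;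
  ★ `explicit_le_surfLeftDensity` — `ρ⁻(t) ≥ 1/2 − log 2 / (4 (t − log y_c))` for every `eᵗ > y_c` (data-free); and
  ★ `inv_four_hundred_lt_surfLeftDensity_log_three` — `1/400 < ρ⁻(log 3)` given `hβ`.

HONEST SCOPE.  Eventual statements (`∀ᶠ n`), no explicit threshold in `n` (the rates `growthGeRate_surfaceMu`,
`growthLe_criticalPoint` are themselves ineffective limits); the floor is a LOWER bound only (the matching limit statement
`surfDensity n y → y μ′(y)/μ(y)` where `μ` is differentiable is the lane's DENSITY-LIMIT car, and the one-sided limit densities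
are `HexSAWSurfaceOrderParameter.lean`, whose `div_le_surfLeftDensity` is the `n = ∞` form of §1 and is fed with the certificate
in §5; no upper bounds on the densities are claimed).  §4's hypothesis is
discharged by the HOME car named there once it is in the tree; any certified `L` may be substituted in §2.

Works consulted: [BeatonBousquetMelouDeGierDuminilCopinGuttmann2014] (§3.1 Proposition 5 and the density paragraph, Theorem 2),
[HammersleyTorrieWhittington1982] (§3), [DuminilCopinSmirnov2012] (Theorem 1), [MadrasSlade1993] (§4.2: where the certificates
come from), [JansevanRensburg2000] (§3.2, eqn (3.17): density as the `log`-derivative of the free energy; background).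
-/

noncomputable section

open Finset Filter Topology
open scoped BigOperators

namespace Literature.Probability.RandomPlanarGeometry.SAW.HV

variable {y L L' δ : ℝ}

/-! ### §1 The chord from `y_c` with explicit rates -/

/-- ★ **THE CHORD WITH RATES**: for `y > 1 + √2` and `μ < s < r < μ(y)`, eventually
`log (r/s) / log (y/(1+√2)) ≤ surfDensity n y` (`C_n(1+√2) ≤ sⁿ` eventually, `growthLe_criticalPoint`; `rⁿ ≤ C_n(y)` eventually,
`growthGeRate_surfaceMu`; then the chord inequality `le_surfDensity_of_ratio_le` with `θ = s/r`).
[cite: BeatonBousquetMelouDeGierDuminilCopinGuttmann2014, §3.1, Proposition 5 (arXiv v5 p. 9) and the last paragraph of §3.1 (p. 10: "the density of vertices on the surface … is positive for y > y_c")] [cite: HammersleyTorrieWhittington1982, §3] -/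
theorem eventually_le_surfDensity_of_rates (hy : 1 + Real.sqrt 2 < y) {r s : ℝ} (hμs : hexConnectiveConstant < s)
    (hsr : s < r) (hr : r < surfaceMu y) :
    ∀ᶠ n : ℕ in atTop, Real.log (r / s) / Real.log (y / (1 + Real.sqrt 2)) ≤ surfDensity n y := by
  have hμ0 : 0 < hexConnectiveConstant := zero_lt_one.trans one_lt_hexConnectiveConstant
  have hy₀ : (0 : ℝ) < 1 + Real.sqrt 2 := by positivity
  have hy0 : 0 < y := hy₀.trans hy
  have hs0 : 0 < s := hμ0.trans hμs
  have hr0 : 0 < r := hs0.trans hsr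
  have e1 : Real.log (r / s) = -Real.log (s / r) := by rw [← Real.log_inv, inv_div]
  have e2 : Real.log (y / (1 + Real.sqrt 2)) = -Real.log ((1 + Real.sqrt 2) / y) := by rw [← Real.log_inv, inv_div]
  rw [e1, e2, neg_div_neg_eq]
  filter_upwards [growthGeRate_surfaceMu hy0 r hr0.le hr, growthLe_criticalPoint s hμs, eventually_ge_atTop 1]
    with n hrn hsn hn
  refine le_surfDensity_of_ratio_le hy₀ hy hn ?_
  rw [div_pow]
  exact div_le_div₀ (pow_nonneg hs0.le _) hsn (pow_pos hr0 _) hrn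

/-! ### §2 The floor of a certificate `L ≤ μ(y)²` -/

/-- **The surface-density floor of a certified value `L` at fugacity `y`**: `surfDensityFloor L y := log (L/μ²) / (2 log (y/(1+√2)))`.
[cite: BeatonBousquetMelouDeGierDuminilCopinGuttmann2014, §3.1, Proposition 5 (arXiv v5 p. 9) and the last paragraph of §3.1 (p. 10: "the density of vertices on the surface … is positive for y > y_c")] -/
def surfDensityFloor (L y : ℝ) : ℝ :=
  Real.log (L / hexConnectiveConstant ^ 2) / (2 * Real.log (y / (1 + Real.sqrt 2)))

/-- The floor is positive exactly when the certified value beats the bulk: `μ² < L → 0 < surfDensityFloor L y` (`y > 1 + √2`).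
[cite: BeatonBousquetMelouDeGierDuminilCopinGuttmann2014, §3.1, Proposition 5 (arXiv v5 p. 9: "μ(y) > μ if y > y_c")] -/
theorem surfDensityFloor_pos (hy : 1 + Real.sqrt 2 < y) (hL : hexConnectiveConstant ^ 2 < L) : 0 < surfDensityFloor L y := by
  have hy₀ : (0 : ℝ) < 1 + Real.sqrt 2 := by positivity
  have hμ : 0 < hexConnectiveConstant ^ 2 := pow_pos (zero_lt_one.trans one_lt_hexConnectiveConstant) 2
  exact div_pos (Real.log_pos ((one_lt_div hμ).2 hL)) (mul_pos two_pos (Real.log_pos ((one_lt_div hy₀).2 hy)))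

/-- The floor is monotone in the certified value (`y > 1 + √2`, `0 < L ≤ L'`): better certificates give better densities.
[cite: BeatonBousquetMelouDeGierDuminilCopinGuttmann2014, §3.1, Proposition 5 (arXiv v5 p. 9)] -/
theorem surfDensityFloor_mono (hy : 1 + Real.sqrt 2 < y) (hL : 0 < L) (hLL : L ≤ L') :
    surfDensityFloor L y ≤ surfDensityFloor L' y := by
  have hy₀ : (0 : ℝ) < 1 + Real.sqrt 2 := by positivity
  have hμ : 0 < hexConnectiveConstant ^ 2 := pow_pos (zero_lt_one.trans one_lt_hexConnectiveConstant) 2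
  have hlog : 0 < 2 * Real.log (y / (1 + Real.sqrt 2)) := mul_pos two_pos (Real.log_pos ((one_lt_div hy₀).2 hy))
  exact div_le_div_of_nonneg_right (Real.log_le_log (div_pos hL hμ) (div_le_div_of_nonneg_right hLL hμ.le)) hlog.le

/-- The floor of the TRUE value: `surfDensityFloor (μ(y)²) y = log (μ(y)/μ) / log (y/(1+√2))` (`y > 0`).
[cite: BeatonBousquetMelouDeGierDuminilCopinGuttmann2014, §3.1, Proposition 5 (arXiv v5 p. 9)] -/
theorem surfDensityFloor_sq_surfaceMu (y : ℝ) :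
    surfDensityFloor (surfaceMu y ^ 2) y = Real.log (surfaceMu y / hexConnectiveConstant) / Real.log (y / (1 + Real.sqrt 2)) := by
  have hμ0 : 0 < hexConnectiveConstant := zero_lt_one.trans one_lt_hexConnectiveConstant
  have hm : 0 < surfaceMu y := surfaceMu_pos y
  unfold surfDensityFloor
  rw [← div_pow, Real.log_pow, Nat.cast_ofNat]
  field_simp

/-- ★★ **EVERY `δ` BELOW THE FLOOR OF A CERTIFICATE IS AN EVENTUAL LOWER BOUND ON THE DENSITY**: for `y > 1 + √2`, a certified
`0 < L ≤ μ(y)²` and any `δ < surfDensityFloor L y`, eventually `δ ≤ surfDensity n y`.  Proof: for `δ ≤ 0` by `surfDensity ≥ 0`;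
else `δ · log (y/y_c) < log (μ(y)/μ)`, choose `log s = log μ + g/3`, `log r = log μ(y) − g/3` with `g` the gap, and apply §1.
[cite: BeatonBousquetMelouDeGierDuminilCopinGuttmann2014, §3.1, Proposition 5 (arXiv v5 p. 9) and the last paragraph of §3.1 (p. 10: "the density of vertices on the surface … is positive for y > y_c")] [cite: HammersleyTorrieWhittington1982, §3] -/
theorem eventually_le_surfDensity_of_lt_floor (hy : 1 + Real.sqrt 2 < y) (hL : 0 < L) (hLμ : L ≤ surfaceMu y ^ 2)
    (hδ : δ < surfDensityFloor L y) : ∀ᶠ n : ℕ in atTop, δ ≤ surfDensity n y := by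
  have hμ0 : 0 < hexConnectiveConstant := zero_lt_one.trans one_lt_hexConnectiveConstant
  have hy₀ : (0 : ℝ) < 1 + Real.sqrt 2 := by positivity
  have hy0 : 0 < y := hy₀.trans hy
  have hm : 0 < surfaceMu y := surfaceMu_pos y
  by_cases hδ0 : δ ≤ 0
  · exact Eventually.of_forall fun n => hδ0.trans (surfDensity_nonneg n hy0.le)
  have hδ0 : 0 < δ := not_le.1 hδ0
  have hA : 0 < Real.log (y / (1 + Real.sqrt 2)) := Real.log_pos ((one_lt_div hy₀).2 hy)
  -- `δ < floor L ≤ floor (μ(y)²) = log (μ(y)/μ) / A`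
  have hδ' : δ < Real.log (surfaceMu y / hexConnectiveConstant) / Real.log (y / (1 + Real.sqrt 2)) := by
    rw [← surfDensityFloor_sq_surfaceMu]
    exact hδ.trans_le (surfDensityFloor_mono hy hL hLμ)
  rw [lt_div_iff₀ hA, Real.log_div hm.ne' hμ0.ne'] at hδ'
  -- the gap and the rates
  set τ : ℝ := δ * Real.log (y / (1 + Real.sqrt 2)) with hτ
  have hτ0 : 0 < τ := mul_pos hδ0 hA
  set g : ℝ := Real.log (surfaceMu y) - Real.log hexConnectiveConstant - τ with hg
  have hg0 : 0 < g := by rw [hg]; linarith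
  set s : ℝ := Real.exp (Real.log hexConnectiveConstant + g / 3) with hs
  set r : ℝ := Real.exp (Real.log (surfaceMu y) - g / 3) with hr
  have hμs : hexConnectiveConstant < s := by
    rw [hs, ← Real.exp_log hμ0, Real.exp_lt_exp, Real.log_exp]; linarith
  have hsr : s < r := by rw [hs, hr, Real.exp_lt_exp]; linarith
  have hrm : r < surfaceMu y := by
    rw [hr, ← Real.exp_log hm, Real.exp_lt_exp, Real.log_exp]; linarith
  have hlog : Real.log (r / s) = Real.log (surfaceMu y) - Real.log hexConnectiveConstant - 2 * g / 3 := by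
    rw [hr, hs, Real.log_div (Real.exp_pos _).ne' (Real.exp_pos _).ne', Real.log_exp, Real.log_exp]; ring
  have hδlt : δ < Real.log (r / s) / Real.log (y / (1 + Real.sqrt 2)) := by
    rw [lt_div_iff₀ hA, hlog]; linarith
  filter_upwards [eventually_le_surfDensity_of_rates hy hμs hsr hrm] with n hn
  exact hδlt.le.trans hn

/-- ★ **PACKAGED: half the floor is an explicit eventual lower bound** — for `y > 1 + √2` and a certified `μ² < L ≤ μ(y)²`,
`0 < surfDensityFloor L y / 2` and eventually `surfDensityFloor L y / 2 ≤ surfDensity n y`.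
[cite: BeatonBousquetMelouDeGierDuminilCopinGuttmann2014, §3.1, Proposition 5 (arXiv v5 p. 9) and the last paragraph of §3.1 (p. 10: "the density of vertices on the surface … is positive for y > y_c")] -/
theorem eventually_half_floor_le_surfDensity (hy : 1 + Real.sqrt 2 < y) (hμL : hexConnectiveConstant ^ 2 < L)
    (hLμ : L ≤ surfaceMu y ^ 2) :
    0 < surfDensityFloor L y / 2 ∧ ∀ᶠ n : ℕ in atTop, surfDensityFloor L y / 2 ≤ surfDensity n y := by
  have hF : 0 < surfDensityFloor L y := surfDensityFloor_pos hy hμL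
  have hL : 0 < L := (pow_pos (zero_lt_one.trans one_lt_hexConnectiveConstant) 2).trans hμL
  exact ⟨half_pos hF, eventually_le_surfDensity_of_lt_floor hy hL hLμ (half_lt_self hF)⟩

/-! ### §3 Data-free: the explicit rate toward the maximal density `1/2` -/

/-- ★ **THE DATA-FREE FLOOR IN CLOSED FORM**: for `y > 1 + √2`, `surfDensityFloor y y = 1/2 − log 2 / (4 log (y/(1+√2)))`
(`μ² = 2 + √2 = √2 · (1 + √2)` — `μ = x_c⁻¹`, `x_c² (2+√2) = 1` — and `log √2 = (log 2)/2`).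
[cite: DuminilCopinSmirnov2012, Theorem 1] [cite: BeatonBousquetMelouDeGierDuminilCopinGuttmann2014, Theorem 2 (arXiv v5 p. 3)] -/
theorem surfDensityFloor_self (hy : 1 + Real.sqrt 2 < y) :
    surfDensityFloor y y = 1 / 2 - Real.log 2 / (4 * Real.log (y / (1 + Real.sqrt 2))) := by
  have hy₀ : (0 : ℝ) < 1 + Real.sqrt 2 := by positivity
  have hy0 : 0 < y := hy₀.trans hy
  have hs : (0 : ℝ) < Real.sqrt 2 := by positivity
  have hA : 0 < Real.log (y / (1 + Real.sqrt 2)) := Real.log_pos ((one_lt_div hy₀).2 hy)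
  have h22 : (2 : ℝ) + Real.sqrt 2 = Real.sqrt 2 * (1 + Real.sqrt 2) := by
    have h : Real.sqrt 2 * Real.sqrt 2 = 2 := Real.mul_self_sqrt (by norm_num)
    rw [mul_add, mul_one, h, add_comm]
  have hμ2 : hexConnectiveConstant ^ 2 = 2 + Real.sqrt 2 := by
    -- `μ = x_c⁻¹`, `x_c² (2+√2) = 1` (the tree's `hexConnectiveConstant_sq`, re-derived to keep imports light)
    rw [hexConnectiveConstant_eq_inv, inv_pow]; exact inv_eq_of_mul_eq_one_right hexCriticalFugacity_sq
  have hnum : Real.log (y / hexConnectiveConstant ^ 2) = Real.log (y / (1 + Real.sqrt 2)) - Real.log 2 / 2 := by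
    rw [hμ2, h22, Real.log_div hy0.ne' (mul_pos hs hy₀).ne', Real.log_mul hs.ne' hy₀.ne',
      Real.log_sqrt (by norm_num : (0 : ℝ) ≤ 2), Real.log_div hy0.ne' hy₀.ne']
    ring
  unfold surfDensityFloor
  rw [hnum]
  field_simp
  ring

/-- ★★ **THE MAXIMAL DENSITY IS APPROACHED AT AN EXPLICIT LOGARITHMIC RATE (data-free)**: for `y > 1 + √2` and every
`δ < 1/2 − log 2 / (4 log (y/(1+√2)))`, eventually `δ ≤ surfDensity n y` (`L = y ≤ μ(y)²` from `√y ≤ μ(y)`, §2, §3's closed form;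
positive content exactly for `y > μ² = 2 + √2`, where it makes the tree's `eventually_le_surfDensity_of_gt_sq` explicit).
[cite: BeatonBousquetMelouDeGierDuminilCopinGuttmann2014, §3.1, Proposition 5 (arXiv v5 p. 9: "μ(y) ≥ max(μ, √y)") and the last paragraph of §3.1 (p. 10: "the density of vertices on the surface … is positive for y > y_c")] [cite: HammersleyTorrieWhittington1982, §3] -/
theorem eventually_le_surfDensity_explicit (hy : 1 + Real.sqrt 2 < y)
    (hδ : δ < 1 / 2 - Real.log 2 / (4 * Real.log (y / (1 + Real.sqrt 2)))) :
    ∀ᶠ n : ℕ in atTop, δ ≤ surfDensity n y := by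
  have hy0 : 0 < y := lt_trans (by positivity) hy
  have hL : y ≤ surfaceMu y ^ 2 := by
    calc y = Real.sqrt y ^ 2 := (Real.sq_sqrt hy0.le).symm
      _ ≤ surfaceMu y ^ 2 := by gcongr; exact sqrt_le_surfaceMu hy0
  rw [← surfDensityFloor_self hy] at hδ
  exact eventually_le_surfDensity_of_lt_floor hy hy0 hL hδ

/-! ### §4 With data: `y = 3` and the length-`12` certificate `400/117 ≤ μ(3)²` -/

/-- Numerics: `1.41421 < √2 < 1.41422`. [cite: DuminilCopinSmirnov2012, Theorem 1] -/
theorem sqrt_two_mem_Ioo : (1.41421 : ℝ) < Real.sqrt 2 ∧ Real.sqrt 2 < 1.41422 := by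
  constructor
  · rw [Real.lt_sqrt (by norm_num)]; norm_num
  · rw [Real.sqrt_lt' (by norm_num)]; norm_num

/-- ★ **THE FLOOR AT `y = 3` OF THE LENGTH-`12` CERTIFICATE EXCEEDS `1/400`**: `1/400 < surfDensityFloor (400/117) 3`
(`log (L/μ²) ≥ 1 − μ²/L = 1 − (2+√2)·117/400 > 0.00134`; `log (3/(1+√2)) ≤ 3/(1+√2) − 1 = 3√2 − 4 < 0.2427`).
[cite: DuminilCopinSmirnov2012, Theorem 1] [cite: BeatonBousquetMelouDeGierDuminilCopinGuttmann2014, Theorem 2 (arXiv v5 p. 3)] -/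
theorem inv_four_hundred_lt_surfDensityFloor_three : (1 : ℝ) / 400 < surfDensityFloor (400 / 117) 3 := by
  obtain ⟨hs1, hs2⟩ := sqrt_two_mem_Ioo
  have hy₀ : (0 : ℝ) < 1 + Real.sqrt 2 := by positivity
  have hμ2 : hexConnectiveConstant ^ 2 = 2 + Real.sqrt 2 := by
    -- `μ = x_c⁻¹`, `x_c² (2+√2) = 1` (the tree's `hexConnectiveConstant_sq`, re-derived to keep imports light)
    rw [hexConnectiveConstant_eq_inv, inv_pow]; exact inv_eq_of_mul_eq_one_right hexCriticalFugacity_sq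
  have hq0 : (0 : ℝ) < 3 / (1 + Real.sqrt 2) := div_pos (by norm_num) hy₀
  have hnum : (0.00134 : ℝ) ≤ Real.log (400 / 117 / hexConnectiveConstant ^ 2) := by
    rw [hμ2]
    have h := Real.one_sub_inv_le_log_of_pos (div_pos (by norm_num : (0 : ℝ) < 400 / 117) (by positivity : (0 : ℝ) < 2 + Real.sqrt 2))
    rw [inv_div] at h
    have h' : (2 + Real.sqrt 2) / (400 / 117) ≤ 1 - 0.00134 := by
      rw [div_le_iff₀ (by norm_num : (0 : ℝ) < 400 / 117)]; nlinarith
    linarith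
  have hden : Real.log (3 / (1 + Real.sqrt 2)) ≤ 0.2427 := by
    have h := Real.log_le_sub_one_of_pos hq0
    have : 3 / (1 + Real.sqrt 2) - 1 ≤ (0.2427 : ℝ) := by
      rw [sub_le_iff_le_add, div_le_iff₀ hy₀]; nlinarith
    exact h.trans this
  have hdenpos : 0 < Real.log (3 / (1 + Real.sqrt 2)) := Real.log_pos ((one_lt_div hy₀).2 (by nlinarith))
  unfold surfDensityFloor
  rw [div_lt_div_iff₀ (by norm_num : (0 : ℝ) < 400) (mul_pos two_pos hdenpos)]
  nlinarith

/-- ★★ **AT `y = 3`, EVENTUALLY AT LEAST ONE VERTEX IN `400` LIES ON THE SURFACE, ON AVERAGE** — given the certificate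
`400/117 ≤ μ(3)²` (hypothesis `hβ`, kernel-certified in the lane from the irreducible positive wall bridges of length `≤ 12`):
eventually `1/400 ≤ surfDensity n 3`.  (`y = 3` lies in the window `(y_c, μ²]` where the tree had positivity only infinitely often.)
[cite: BeatonBousquetMelouDeGierDuminilCopinGuttmann2014, §3.1, Proposition 5 (arXiv v5 p. 9) and the last paragraph of §3.1 (p. 10: "the density of vertices on the surface … is positive for y > y_c")] [cite: HammersleyTorrieWhittington1982, §3] -/
theorem eventually_inv_four_hundred_le_surfDensity_three (hβ : (400 : ℝ) / 117 ≤ surfaceMu 3 ^ 2) :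
    ∀ᶠ n : ℕ in atTop, (1 : ℝ) / 400 ≤ surfDensity n 3 := by
  have h3 : 1 + Real.sqrt 2 < (3 : ℝ) := by nlinarith [sqrt_two_mem_Ioo.2]
  exact eventually_le_surfDensity_of_lt_floor h3 (by norm_num) hβ inv_four_hundred_lt_surfDensityFloor_three

/-- The same at every `y ≥ 3` carrying the certificate `400/117 ≤ μ(y)²` (it holds for all `y ≥ 3` by monotonicity of the bridge
census in `y`): every `δ < log ((400/117)/μ²) / (2 log (y/(1+√2)))` is an eventual lower bound on `surfDensity n y`.
[cite: BeatonBousquetMelouDeGierDuminilCopinGuttmann2014, §3.1, Proposition 5 (arXiv v5 p. 9) and the last paragraph of §3.1 (p. 10: "the density of vertices on the surface … is positive for y > y_c")] -/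
theorem eventually_le_surfDensity_of_cert (hy3 : 3 ≤ y) (hβ : (400 : ℝ) / 117 ≤ surfaceMu y ^ 2)
    (hδ : δ < surfDensityFloor (400 / 117) y) : ∀ᶠ n : ℕ in atTop, δ ≤ surfDensity n y := by
  have h3 : 1 + Real.sqrt 2 < y := by nlinarith [sqrt_two_mem_Ioo.2]
  exact eventually_le_surfDensity_of_lt_floor h3 (by norm_num) hβ hδ

/-! ### §5 The same floors for the limiting ORDER PARAMETER (the one-sided densities `ρ⁻ ≤ ρ⁺` of the surface free energy)

`HexSAWSurfaceOrderParameter.lean` (tree) defines `surfFreeEnergy t = log μ(eᵗ)`, its left/right derivatives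
`surfLeftDensity t ≤ surfRightDensity t` (the limiting densities of surface vertices, between which every subsequential limit
of `surfDensity n (eᵗ)` lies — lane DENSITY-LIMIT car), and proves the chord bound `div_le_surfLeftDensity :
(F(t) − log μ)/(t − log y_c) ≤ ρ⁻(t)` for `eᵗ > y_c`.  The chord value IS `surfDensityFloor (μ(eᵗ)²) (eᵗ)`, so every
certificate `L ≤ μ(eᵗ)²` bounds the order parameter below EXPLICITLY, with the same numbers as §3–§4 and no `∀ᶠ`. -/

/-- The certificate floor is below the chord value: `0 < L ≤ μ(y)²`, `y > y_c` ⇒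
`surfDensityFloor L y ≤ log (μ(y)/μ) / log (y/y_c)`. [cite: BeatonBousquetMelouDeGierDuminilCopinGuttmann2014, §3.1, Proposition 5 (arXiv v5 p. 9)] -/
theorem surfDensityFloor_le_chord (hy : 1 + Real.sqrt 2 < y) (hL : 0 < L) (hLμ : L ≤ surfaceMu y ^ 2) :
    surfDensityFloor L y ≤ Real.log (surfaceMu y / hexConnectiveConstant) / Real.log (y / (1 + Real.sqrt 2)) := by
  rw [← surfDensityFloor_sq_surfaceMu y]
  exact surfDensityFloor_mono hy hL hLμ

/-- **★ Certificate ⇒ explicit lower bound on the ORDER PARAMETER: `0 < L ≤ μ(eᵗ)²`, `eᵗ > y_c` ⇒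
`surfDensityFloor L (eᵗ) ≤ ρ⁻(t)`** (the tree's chord bound `div_le_surfLeftDensity` fed with the certificate).
[cite: BeatonBousquetMelouDeGierDuminilCopinGuttmann2014, §3.1, Proposition 5 (arXiv v5 p. 9) and the last paragraph of §3.1 (p. 10: "is positive for y > y_c"); HammersleyTorrieWhittington1982, §3] -/
theorem surfDensityFloor_le_surfLeftDensity {t L : ℝ} (ht : 1 + Real.sqrt 2 < Real.exp t) (hL : 0 < L)
    (hLμ : L ≤ surfaceMu (Real.exp t) ^ 2) : surfDensityFloor L (Real.exp t) ≤ surfLeftDensity t := by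
  refine (surfDensityFloor_le_chord ht hL hLμ).trans ?_
  have hμ0 : 0 < hexConnectiveConstant := zero_lt_one.trans one_lt_hexConnectiveConstant
  have hyc : (0 : ℝ) < 1 + Real.sqrt 2 := by positivity
  have h := div_le_surfLeftDensity ht
  rw [surfFreeEnergy_apply] at h
  rwa [Real.log_div (surfaceMu_pos _).ne' hμ0.ne', Real.log_div (Real.exp_pos t).ne' hyc.ne', Real.log_exp]

/-- The same bound for the right density `ρ⁺(t) ≥ ρ⁻(t)`. [cite: BeatonBousquetMelouDeGierDuminilCopinGuttmann2014, §3.1, Proposition 5 (arXiv v5 p. 9)] -/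
theorem surfDensityFloor_le_surfRightDensity {t L : ℝ} (ht : 1 + Real.sqrt 2 < Real.exp t) (hL : 0 < L)
    (hLμ : L ≤ surfaceMu (Real.exp t) ^ 2) : surfDensityFloor L (Real.exp t) ≤ surfRightDensity t :=
  (surfDensityFloor_le_surfLeftDensity ht hL hLμ).trans (surfLeftDensity_le_surfRightDensity t)

/-- **★ DATA-FREE order-parameter bound: `ρ⁻(t) ≥ 1/2 − log 2 / (4 (t − log y_c))` for every `eᵗ > y_c = 1 + √2`** — the
limiting surface density tends to its maximal value `1/2` as `t → ∞` at least at this explicit rate (`L = eᵗ ≤ μ(eᵗ)²` from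
`μ(y) ≥ √y`). [cite: BeatonBousquetMelouDeGierDuminilCopinGuttmann2014, §3.1, Proposition 5 (arXiv v5 p. 9: "μ(y) ≥ max(μ, √y)")] -/
theorem explicit_le_surfLeftDensity {t : ℝ} (ht : 1 + Real.sqrt 2 < Real.exp t) :
    1 / 2 - Real.log 2 / (4 * (t - Real.log (1 + Real.sqrt 2))) ≤ surfLeftDensity t := by
  have hy0 : 0 < Real.exp t := Real.exp_pos t
  have hyc : (0 : ℝ) < 1 + Real.sqrt 2 := by positivity
  have hL : Real.exp t ≤ surfaceMu (Real.exp t) ^ 2 := by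
    calc Real.exp t = Real.sqrt (Real.exp t) ^ 2 := (Real.sq_sqrt hy0.le).symm
      _ ≤ surfaceMu (Real.exp t) ^ 2 := by gcongr; exact sqrt_le_surfaceMu hy0
  have h := surfDensityFloor_le_surfLeftDensity ht hy0 hL
  rw [surfDensityFloor_self ht, Real.log_div hy0.ne' hyc.ne', Real.log_exp] at h
  exact h

/-- **★ With the length-`12` certificate: `1/400 < ρ⁻(log 3) ≤ ρ⁺(log 3)`** — at `y = 3` (inside `(y_c, μ²]`) the limiting
density of surface vertices exceeds `1/400`, given `400/117 ≤ μ(3)²` (hypothesis `hβ`, kernel-certified in the lane by the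
HOME car «STRIP-ADSORPTION-WITNESS»). [cite: BeatonBousquetMelouDeGierDuminilCopinGuttmann2014, §3.1, last paragraph (arXiv v5 p. 10: "is positive for y > y_c"); MadrasSlade1993, §4.2] -/
theorem inv_four_hundred_lt_surfLeftDensity_log_three (hβ : (400 : ℝ) / 117 ≤ surfaceMu 3 ^ 2) :
    (1 : ℝ) / 400 < surfLeftDensity (Real.log 3) := by
  have h3 : Real.exp (Real.log 3) = (3 : ℝ) := Real.exp_log (by norm_num)
  have ht : 1 + Real.sqrt 2 < Real.exp (Real.log 3) := by rw [h3]; nlinarith [sqrt_two_mem_Ioo.2]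
  have h := surfDensityFloor_le_surfLeftDensity (L := 400 / 117) ht (by norm_num) (by rw [h3]; exact hβ)
  rw [h3] at h
  exact inv_four_hundred_lt_surfDensityFloor_three.trans_le h

end Literature.Probability.RandomPlanarGeometry.SAW.HV

end
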